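import Mathlib
import HarnessLib
import Summits.ResolutionOfSingularities.ResolutionOfSingularities.Theorems.HomologicalConductorNoZenoStableAnnihilatorReduction

/-!
# Crux `NoZenoR` / `NoZeno` (stmt-ResolutionOfSingularities-19943 / -16483), line
# `sandwich-cluster`, S3 Layer 2 — CA-layer V: the STABLE Hom `Hom̲(M, N) = Hom(M, N) / P(M, N)`,
# `s̲ann(M) = ann_T End̲(M)`, and the fixed-cover normal form of stable annihilation

Route `ResolutionOfSingularities/HomologicalConductor`.  OURS (cell res-hironaka, crux chain W4.4,
seat res-L0-w44-stub-5 = res-D-pv-037); nothing here is a statement of the manuscript under review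
(Hironaka 2017); AI-written, weaker than expert review.

The proof of THEOREM A (CRUX-PLAN W4.4 v4.0.2 §1.3, planner res-L0-w44-plan-1) rewrites the stable
annihilator of a module as the annihilator of a `T`-MODULE: `s̲ann(L) = ann_T End̲(L)`, where
`End̲(L) = End_T(L) / P(L, L)` and `P(M, N) ⊆ Hom_T(M, N)` is the submodule of maps factoring
through a finitely generated projective module; the full-sheaf package (§1.2 (vi)) then embeds
`End̲(M)` into `H¹(X, M̃^∨ ⊗ 𝒦)`, using the description «`P(M, M)` = the image of
`(M*)^N = Hom(M, T^N) → End M`» for a chosen finite free cover `T^N ↠ M`, and LEMMA L computes the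
annihilator of that `H¹`.  This file is the scheme-free algebra of that step:

* `projFactoring T M N` — the submodule `P(M, N)` of `M →ₗ[T] N` of maps factoring through a
  finitely generated projective `T`-module; a two-sided ideal under composition
  (`comp_mem_projFactoring_left` / `_right`);
* `StableHom T M N := (M →ₗ[T] N) ⧸ P(M, N)` and `StableEnd T M := StableHom T M M` (`End̲(M)`);
* `mem_projFactoring_iff_exists_comp_eq` — **fixed-cover normal form**: for ANY surjection
  `q : P ↠ N` from a finitely generated projective `P`, `φ ∈ P(M, N)` iff `φ = q ∘ ψ` for some
  `ψ : M → P` (lift through `q` by projectivity); `projFactoring_eq_range_compRight` is the same as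
  `P(M, N) = range (q ∘ —)`;
* `stablyAnnihilates_iff_smul_id_mem_projFactoring` — the bridge to A0 (`StablyAnnihilates`,
  `…StableAnnihilatorReduction.lean`, in `ModuleCat`): `x ∈ s̲ann(M)` iff `x • id ∈ P(M, M)`;
  `stablyAnnihilates_iff_exists_lift` — iff `x • 𝟙 M` lifts along a chosen finitely generated
  projective cover `q : P ⟶ M` (`ψ ≫ q = x • 𝟙 M`);
* **`stablyAnnihilates_iff_mem_annihilator_stableEnd`** — `x ∈ s̲ann(M)` iff
  `x ∈ ann_T End̲(M)` (`Module.annihilator`).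

References: S. B. Iyengar, R. Takahashi, *Annihilation of cohomology and strong generation of module
categories*, IMRN 2016, Remark 2.13 [`IyengarTakahashi2014`]; the stable module category
`mod T / proj T` is folklore (Auslander–Bridger).
-/

noncomputable section

-- single-problem summit: the doubled namespace component `ResolutionOfSingularities` is forced
set_option linter.dupNamespace false

namespace Summit.ResolutionOfSingularities.ResolutionOfSingularities.Theorems.NoZeno.SandwichCluster

open CategoryTheory Literature.RingTheory.CohomologyAnnihilator

universe u

variable (T : Type u) [CommRing T]
variable (M N : Type u) [AddCommGroup M] [Module T M] [AddCommGroup N] [Module T N]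

/-! ## `P(M, N)`: maps factoring through a finitely generated projective module -/

/-- `P(M, N) ⊆ Hom_T(M, N)`: the `T`-submodule of linear maps `M → N` that factor as `M —ι→ F —π→ N`
through some finitely generated projective `T`-module `F` (closed under sums via `F × F'`, under
scalars via `x • ι`). [folklore] -/
def projFactoring : Submodule T (M →ₗ[T] N) where
  carrier := {φ | ∃ (F : Type u) (_ : AddCommGroup F) (_ : Module T F) (_ : Module.Finite T F)
    (_ : Module.Projective T F) (ι : M →ₗ[T] F) (π : F →ₗ[T] N), φ = π ∘ₗ ι}
  zero_mem' := ⟨T, inferInstance, inferInstance, inferInstance, inferInstance, 0, 0, by simp⟩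
  add_mem' := by
    rintro φ φ' ⟨F, _, _, _, _, ι, π, rfl⟩ ⟨F', _, _, _, _, ι', π', rfl⟩
    refine ⟨F × F', inferInstance, inferInstance, inferInstance, inferInstance, ι.prod ι',
      π.coprod π', ?_⟩
    rw [LinearMap.coprod_comp_prod]
  smul_mem' := by
    rintro x φ ⟨F, _, _, _, _, ι, π, rfl⟩
    exact ⟨F, inferInstance, inferInstance, inferInstance, inferInstance, x • ι, π,
      by rw [LinearMap.comp_smul]⟩

variable {T M N}

/-- Unfolding of `P(M, N)`. [folklore] -/
theorem mem_projFactoring_iff {φ : M →ₗ[T] N} :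
    φ ∈ projFactoring T M N ↔ ∃ (F : Type u) (_ : AddCommGroup F) (_ : Module T F)
      (_ : Module.Finite T F) (_ : Module.Projective T F) (ι : M →ₗ[T] F) (π : F →ₗ[T] N),
        φ = π ∘ₗ ι :=
  Iff.rfl

/-- A map factoring through a finitely generated projective module lies in `P(M, N)`. [folklore] -/
theorem comp_mem_projFactoring {F : Type u} [AddCommGroup F] [Module T F] [Module.Finite T F]
    [Module.Projective T F] (ι : M →ₗ[T] F) (π : F →ₗ[T] N) : π ∘ₗ ι ∈ projFactoring T M N :=
  ⟨F, inferInstance, inferInstance, inferInstance, inferInstance, ι, π, rfl⟩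

/-- `P(-, -)` is a right ideal under composition: `φ ∈ P(M, N) ⇒ φ ∘ α ∈ P(M', N)`. [folklore] -/
theorem comp_mem_projFactoring_right {M' : Type u} [AddCommGroup M'] [Module T M'] {φ : M →ₗ[T] N}
    (hφ : φ ∈ projFactoring T M N) (α : M' →ₗ[T] M) : φ ∘ₗ α ∈ projFactoring T M' N := by
  obtain ⟨F, _, _, _, _, ι, π, rfl⟩ := hφ
  rw [LinearMap.comp_assoc]
  exact comp_mem_projFactoring (ι ∘ₗ α) π

/-- `P(-, -)` is a left ideal under composition: `φ ∈ P(M, N) ⇒ β ∘ φ ∈ P(M, N')`. [folklore] -/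
theorem comp_mem_projFactoring_left {N' : Type u} [AddCommGroup N'] [Module T N'] {φ : M →ₗ[T] N}
    (hφ : φ ∈ projFactoring T M N) (β : N →ₗ[T] N') : β ∘ₗ φ ∈ projFactoring T M N' := by
  obtain ⟨F, _, _, _, _, ι, π, rfl⟩ := hφ
  rw [← LinearMap.comp_assoc]
  exact comp_mem_projFactoring ι (β ∘ₗ π)

/-- **Fixed-cover normal form.** For ANY surjection `q : P ↠ N` from a finitely generated projective
module `P`, a map `φ : M → N` factors through some finitely generated projective iff it lifts along
`q`: `φ = q ∘ ψ` (lift the second factor `π : F → N` through `q` by projectivity of `F`). This is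
«`P(M, M)` = the image of `(M*)^N = Hom(M, T^N) → End M`, `Σ f_j(−) m_j`» for the free cover
attached to generators `m_1, …, m_N`. [folklore] -/
theorem mem_projFactoring_iff_exists_comp_eq {P : Type u} [AddCommGroup P] [Module T P]
    [Module.Finite T P] [Module.Projective T P] (q : P →ₗ[T] N) (hq : Function.Surjective q)
    {φ : M →ₗ[T] N} : φ ∈ projFactoring T M N ↔ ∃ ψ : M →ₗ[T] P, φ = q ∘ₗ ψ := by
  constructor
  · rintro ⟨F, _, _, _, _, ι, π, rfl⟩
    obtain ⟨g, hg⟩ := Module.projective_lifting_property q π hq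
    exact ⟨g ∘ₗ ι, by rw [← LinearMap.comp_assoc, hg]⟩
  · rintro ⟨ψ, rfl⟩
    exact comp_mem_projFactoring ψ q

/-- The fixed-cover normal form as an equality of submodules: `P(M, N) = range (ψ ↦ q ∘ ψ)` for any
finitely generated projective cover `q : P ↠ N`. [folklore] -/
theorem projFactoring_eq_range_compRight {P : Type u} [AddCommGroup P] [Module T P]
    [Module.Finite T P] [Module.Projective T P] (q : P →ₗ[T] N) (hq : Function.Surjective q) :
    projFactoring T M N =
      LinearMap.range (LinearMap.compRight T q : (M →ₗ[T] P) →ₗ[T] (M →ₗ[T] N)) := by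
  ext φ
  rw [mem_projFactoring_iff_exists_comp_eq q hq, LinearMap.mem_range]
  simp only [LinearMap.compRight_apply, eq_comm]

/-! ## The stable Hom and the stable endomorphism module -/

variable (T M N)

/-- The **stable Hom** `Hom̲_T(M, N) := Hom_T(M, N) / P(M, N)` (morphisms of the stable category
`mod T / proj T`), as a `T`-module (a reducible synonym of the quotient module, so that the
`Submodule.Quotient` API applies verbatim). [folklore] -/
abbrev StableHom : Type u :=
  (M →ₗ[T] N) ⧸ projFactoring T M N

/-- The **stable endomorphism module** `End̲_T(M) := End_T(M) / P(M, M)`. [folklore] -/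
abbrev StableEnd : Type u :=
  StableHom T M M

variable {T M N}

/-- A class vanishes in `Hom̲(M, N)` iff the map factors through a finitely generated projective
(`Submodule.Quotient.mk_eq_zero`, recorded for the consumer). [folklore] -/
theorem stableHom_mk_eq_zero_iff {φ : M →ₗ[T] N} :
    (Submodule.Quotient.mk φ : StableHom T M N) = 0 ↔ φ ∈ projFactoring T M N :=
  Submodule.Quotient.mk_eq_zero _

/-! ## Stable annihilation = annihilation of `End̲` -/

/-- Bridge to A0: `x` stably annihilates `M` (`StablyAnnihilates`, in `ModuleCat T`) iff the
homothety `x • id` lies in `P(M, M)`. [folklore] -/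
theorem stablyAnnihilates_iff_smul_id_mem_projFactoring (x : T) :
    StablyAnnihilates T x (ModuleCat.of T M) ↔
      (x • LinearMap.id : M →ₗ[T] M) ∈ projFactoring T M M := by
  constructor
  · rintro ⟨P, hPfin, hP, ι, π, h⟩
    haveI := hPfin
    haveI : Module.Projective T P := P.projective_of_module_projective
    refine ⟨P, inferInstance, inferInstance, inferInstance, inferInstance, ι.hom, π.hom, ?_⟩
    ext m
    have := apply_apply_eq_smul_of_comp_eq_smul_id h m
    simpa using this.symm
  · rintro ⟨F, _, _, _, _, ι, π, h⟩
    refine ⟨ModuleCat.of T F, inferInstance, inferInstance, ModuleCat.ofHom ι, ModuleCat.ofHom π,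
      ?_⟩
    ext m
    have := LinearMap.congr_fun h m
    simpa using this.symm

/-- **Fixed-cover form of stable annihilation** (`ModuleCat`): for any epimorphism `q : P ⟶ M`
from a finitely generated projective `P`, `x` stably annihilates `M` iff `x • 𝟙 M` lifts along `q`
(`ψ ≫ q = x • 𝟙 M`; `Projective.factorThru`). [cite: IyengarTakahashi2014, Remark 2.13] -/
theorem stablyAnnihilates_iff_exists_lift (x : T) {P M' : ModuleCat.{u} T} [Module.Finite T P]
    (hP : Projective P) (q : P ⟶ M') [Epi q] :
    StablyAnnihilates T x M' ↔ ∃ ψ : M' ⟶ P, ψ ≫ q = x • 𝟙 M' := by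
  constructor
  · rintro ⟨P', _, hP', ι, π, h⟩
    haveI := hP'
    exact ⟨ι ≫ Projective.factorThru π q, by rw [Category.assoc, Projective.factorThru_comp, h]⟩
  · rintro ⟨ψ, hψ⟩
    exact ⟨P, ‹_›, hP, ψ, q, hψ⟩

/-- `x • [φ] = [φ ∘ (x • id)]` vanishes in `Hom̲(M, N)` as soon as `x • id ∈ P(M, M)`. [folklore] -/
theorem smul_stableHom_eq_zero_of_smul_id_mem {x : T}
    (hx : (x • LinearMap.id : M →ₗ[T] M) ∈ projFactoring T M M) (c : StableHom T M N) :
    x • c = 0 := by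
  obtain ⟨φ, rfl⟩ := Submodule.Quotient.mk_surjective _ c
  rw [← Submodule.Quotient.mk_smul, Submodule.Quotient.mk_eq_zero]
  have : x • φ = φ ∘ₗ (x • LinearMap.id) := by rw [LinearMap.comp_smul, LinearMap.comp_id]
  rw [this]
  exact comp_mem_projFactoring_left hx φ

/-- **`s̲ann(M) = ann_T End̲(M)`** (CRUX-PLAN W4.4 v4.0.2 §1.3): `x` stably annihilates `M` iff `x`
annihilates the stable endomorphism module `End̲(M) = End_T(M) / P(M, M)` — `⇒`: `x • [φ] =
[φ ∘ (x • id)]` and `P` is an ideal under composition; `⇐`: apply to `[id]`. [folklore] -/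
theorem stablyAnnihilates_iff_mem_annihilator_stableEnd (x : T) :
    StablyAnnihilates T x (ModuleCat.of T M) ↔ x ∈ Module.annihilator T (StableEnd T M) := by
  rw [stablyAnnihilates_iff_smul_id_mem_projFactoring, Module.mem_annihilator]
  constructor
  · intro hx c
    exact smul_stableHom_eq_zero_of_smul_id_mem hx c
  · intro h
    have h1 := h (Submodule.Quotient.mk LinearMap.id)
    rwa [← Submodule.Quotient.mk_smul, Submodule.Quotient.mk_eq_zero] at h1

/-- `x` annihilates every stable Hom module `Hom̲(M, N)` out of `M` as soon as it stably annihilates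
`M`. [folklore] -/
theorem smul_stableHom_eq_zero_of_stablyAnnihilates {x : T}
    (hx : StablyAnnihilates T x (ModuleCat.of T M)) (c : StableHom T M N) : x • c = 0 :=
  smul_stableHom_eq_zero_of_smul_id_mem
    ((stablyAnnihilates_iff_smul_id_mem_projFactoring x).mp hx) c

end Summit.ResolutionOfSingularities.ResolutionOfSingularities.Theorems.NoZeno.SandwichCluster

end
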